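import Summits.CriticalPhenomena.PercolationContinuityZ3.Theorems.PercNearOneGluingNoHeavyLowerTailTypedReductions
import Literature.Probability.LatticeModels.ProdBernoulliClusterLocality
import Literature.Probability.Percolation.KozmaNitzanPinning
import Literature.Probability.Percolation.PercolationProofs
import Literature.Probability.Percolation.OpenGraphCuts
import HarnessLib

/-!
# `NoHeavyLowerTail` (stmt-CriticalPhenomena-4575) — the deterministic base of the common-relay line

Sorry-free proof of the registered stub `stub_deterministicBase` of the typed skeleton (line
common-relay-interpolation, S12): additive Conjecture 1
`P(o ↔ A) − (1 − t) ≤ P(o ↔ b)` (every relay `a ∈ A ≠ ∅` having `P(a ↔ b) ≥ t`) for **0/1 weights**, where the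
product Bernoulli law is carried by the single configuration `ω₀ = {e | w e = 1}` and the claim is the
deterministic transitivity `o ↔ a ↔ b ⇒ o ↔ b`.

Consequence: `noHeavyLowerTail_of_commonRelayStep` — the common-relay interpolation step ALONE now implies the crux
(by `noHeavyLowerTail_of_commonRelay`, p174449).
-/

noncomputable section

namespace Summit.CriticalPhenomena.PercolationContinuityZ3.Theorems

open MeasureTheory Set Literature.Probability.LatticeModels Literature.Probability.Percolation
open Summit.CriticalPhenomena.PercolationContinuityZ3.Theses.PercNearOneGluing
open scoped Classical BigOperators

/-- For 0/1 parameters the product Bernoulli measure is carried by the configuration `{e | w e = 1}`. -/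
theorem prodBernoulli_ae_eq_detConfig {ι : Type*} [Countable ι] (w : ι → unitInterval)
    (hw : ∀ e : ι, (w e : ℝ) = 0 ∨ (w e : ℝ) = 1) :
    ∀ᵐ ω ∂prodBernoulli w, ω = {e | (w e : ℝ) = 1} := by
  have h : ∀ e : ι, ∀ᵐ ω ∂prodBernoulli w, (e ∈ ω ↔ (w e : ℝ) = 1) := by
    intro e
    rcases hw e with h0 | h1
    · have he : w e = 0 := Set.Icc.coe_eq_zero.1 h0
      filter_upwards [prodBernoulli_ae_notMem w he] with ω hω
      refine iff_of_false hω ?_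
      rw [h0]; norm_num
    · have he : w e = 1 := Set.Icc.coe_eq_one.1 h1
      filter_upwards [prodBernoulli_ae_mem_of_eq_one w he] with ω hω
      exact iff_of_true hω h1
  filter_upwards [ae_all_iff.2 h] with ω hω
  ext e
  exact hω e

/-- 0/1 parameters: an event missing the carried configuration is null. -/
theorem prodBernoulli_real_eq_zero_of_detConfig_notMem {ι : Type*} [Countable ι] (w : ι → unitInterval)
    (hw : ∀ e : ι, (w e : ℝ) = 0 ∨ (w e : ℝ) = 1) {E : Set (Set ι)}
    (hE : {e | (w e : ℝ) = 1} ∉ E) : (prodBernoulli w).real E = 0 := by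
  have hae := prodBernoulli_ae_eq_detConfig w hw
  rw [measureReal_eq_zero_iff]
  refine measure_mono_null (fun ω hω => ?_) (ae_iff.1 hae)
  simp only [Set.mem_setOf_eq]
  rintro rfl
  exact hE hω

/-- 0/1 parameters: a measurable event containing the carried configuration is almost sure. -/
theorem prodBernoulli_real_eq_one_of_detConfig_mem {ι : Type*} [Countable ι] (w : ι → unitInterval)
    (hw : ∀ e : ι, (w e : ℝ) = 0 ∨ (w e : ℝ) = 1) {E : Set (Set ι)} (hEm : MeasurableSet E)
    (hE : {e | (w e : ℝ) = 1} ∈ E) : (prodBernoulli w).real E = 1 := by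
  have hae := prodBernoulli_ae_eq_detConfig w hw
  have hc : prodBernoulli w Eᶜ = 0 := by
    refine measure_mono_null (fun ω hω => ?_) (ae_iff.1 hae)
    simp only [Set.mem_setOf_eq]
    rintro rfl
    exact hω hE
  have h1 : prodBernoulli w E = 1 := (prob_compl_eq_zero_iff hEm).1 hc
  simp [measureReal_def, h1]

/-- **S12 of the typed skeleton (line common-relay-interpolation): additive Conjecture 1 for 0/1 weights.**
The law is the point mass at `ω₀ = {e | w e = 1}`; if `o ↔ b` in `ω₀` the right side is `1`; otherwise either no relay is
joined to `o` (left side `t − 1 ≤ 0`) or some relay `a` is, and then `a ↮ b` in `ω₀`, forcing `t ≤ P(a ↔ b) = 0`. -/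
theorem stub_deterministicBase :
    ∀ (n : ℕ) (w : Sym2 (Fin n) → unitInterval), (∀ e : Sym2 (Fin n), (w e : ℝ) = 0 ∨ (w e : ℝ) = 1) → ∀ (A : Finset (Fin n)) (o b : Fin n) (t : ℝ), A.Nonempty → (∀ a ∈ A, t ≤ (prodBernoulli w).real (openConn a b)) → (prodBernoulli w).real (⋃ a ∈ A, openConn o a) - (1 - t) ≤ (prodBernoulli w).real (openConn o b) := by
  intro n w hw A o b t hA ht
  obtain ⟨a₁, ha₁⟩ := hA
  have ht1 : t ≤ 1 := (ht a₁ ha₁).trans measureReal_le_one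
  have hU1 : (prodBernoulli w).real (⋃ a ∈ A, openConn o a) ≤ 1 := measureReal_le_one
  have hRHS : 0 ≤ (prodBernoulli w).real (openConn o b) := measureReal_nonneg
  by_cases hb : {e | (w e : ℝ) = 1} ∈ (openConn o b : Set (BondConfig (Fin n)))
  · rw [prodBernoulli_real_eq_one_of_detConfig_mem w hw (measurableSet_openConn_holds o b) hb]
    linarith
  · by_cases hU : {e | (w e : ℝ) = 1} ∈ ⋃ a ∈ A, (openConn o a : Set (BondConfig (Fin n)))
    · obtain ⟨a, ha, hoa⟩ : ∃ a ∈ A, {e | (w e : ℝ) = 1} ∈ (openConn o a : Set (BondConfig (Fin n))) := by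
        simpa only [Set.mem_iUnion, exists_prop] using hU
      have hab : {e | (w e : ℝ) = 1} ∉ (openConn a b : Set (BondConfig (Fin n))) := by
        intro hab
        rw [mem_openConn_iff_reachable] at hoa hab hb
        exact hb (hoa.trans hab)
      have h0 := prodBernoulli_real_eq_zero_of_detConfig_notMem w hw hab
      have hta := ht a ha
      rw [h0] at hta
      linarith
    · rw [prodBernoulli_real_eq_zero_of_detConfig_notMem w hw hU]
      linarith

/-- **The common-relay interpolation step ALONE implies the crux** (S11 of the typed skeleton; the 0/1 base S12 is
`stub_deterministicBase` above, the induction is `noHeavyLowerTail_of_commonRelay`, p174449). -/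
theorem noHeavyLowerTail_of_commonRelayStep :
    (∀ (n : ℕ) (w : Sym2 (Fin n) → unitInterval) (A : Finset (Fin n)) (o b : Fin n), A.Nonempty → (∃ e : Sym2 (Fin n), 0 < (w e : ℝ) ∧ (w e : ℝ) < 1) → (∀ w' : Sym2 (Fin n) → unitInterval, (Finset.univ.filter fun e => 0 < (w' e : ℝ) ∧ (w' e : ℝ) < 1).card < (Finset.univ.filter fun e => 0 < (w e : ℝ) ∧ (w e : ℝ) < 1).card → ∀ (A' : Finset (Fin n)) (o' b' : Fin n) (t : ℝ), A'.Nonempty → (∀ a ∈ A', t ≤ (prodBernoulli w').real (openConn a b')) → (prodBernoulli w').real (⋃ a ∈ A', openConn o' a) - (1 - t) ≤ (prodBernoulli w').real (openConn o' b')) → ∃ e : Sym2 (Fin n), (0 < (w e : ℝ) ∧ (w e : ℝ) < 1) ∧ ∃ a ∈ A, ((prodBernoulli (Function.update w e 0)).real (⋃ a' ∈ A, openConn o a') - (prodBernoulli (Function.update w e 0)).real (openConn o b) ≤ 1 - (prodBernoulli (Function.update w e 0)).real (openConn a b)) ∧ ((prodBernoulli (Function.update w e 1)).real (⋃ a' ∈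 A, openConn o a') - (prodBernoulli (Function.update w e 1)).real (openConn o b) ≤ 1 - (prodBernoulli (Function.update w e 1)).real (openConn a b))) →
    Summit.CriticalPhenomena.PercolationContinuityZ3.Theses.PercNearOneGluing.NoHeavyLowerTail := fun hCRL =>
  noHeavyLowerTail_of_commonRelay hCRL stub_deterministicBase

end Summit.CriticalPhenomena.PercolationContinuityZ3.Theorems

end
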